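import Literature.Computability.QuantumComplexity.ZXCalculusControlAlpha
import HarnessLib

/-!
# ZX-calculus: assembly of JPV LICS 2019 `control-alpha-with-triangles` (NF-L1)

The stages `D0 = 2 ⊗ E4b`, `E4b = 2 ⊗ E4L`, `db 4 α ⊗ E4L = db 4 (π/4) ⊗ E5L` (the (C1) step), `E5L ↝ D8`, `D8 = RHS`
of the printed proof (figures `control-alpha-with-triangles_00 … _13`), each as a lemma.
[cite: JeandelPerdrixVilmart2018, Appendix Lemma 17 (C1); JPV, *A Generic Normal Form for ZX-Diagrams* (LICS 2019), Appendix]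
-/

namespace Literature.Computability.QuantumComplexity

open ZXDiagram

namespace ZXClass

/-- hedge: `𝕀 ⊗ H∪ᵗ ⊗ 𝕀` on four wires. -/
local notation "HC₄" => ((mk (wires 1) ⊠ ((mk hBox ⊠ mk (wires 1)) ⨟ mk cap)) ⊠ mk (wires 1))
/-- the branch `H ⨾ Z(-π/4) ⨾ xLeafL 0 (π/4)`. -/
local notation "P₁" => (mk hBox ⨟ mk (Z 1 1 (-1)) ⨟ mk (xLeafL 0 1))
/-- the (C1) redex block of stage `E4L`. -/
local notation "BLK[" a "]" => ((mk (Z 1 2 a) ⊠ mk (wires 1)) ⨟ (mk (xLeafL 0 (-a)) ⊠ ((mk hBox ⊠ mk (wires 1)) ⨟ mk (Z 2 1 (-1)) ⨟ mk (xLeafL 4 1))) ⨟ mk (Z 2 1 0))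
/-- the block after (C1). -/
local notation "RBLK[" a "]" => ((mk hBox ⊠ mk hBox) ⨟ (mk (Z 1 2 (-1)) ⊠ mk (Z 1 2 a)) ⨟ HC₄ ⨟ (mk (xLeafL 0 (-1)) ⊠ mk (xLeafL 4 a)) ⨟ mk (Z 2 1 0))
/-- common prefix `Z(-π/2) ⨾ Z^{(1,2)} ⨾ (H ⊗ H)`. -/
local notation "PRE" => (mk (Z 1 1 (-2)) ⨟ mk (Z 1 2 0) ⨟ (mk hBox ⊠ mk hBox))

/-- Bookkeeping mover (scalars / associativity of `⊗`). [cite: JeandelPerdrixVilmart2018, §2.2 (only topology matters; scalars)] -/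
private theorem mv13 (s : ZXClass 0 0) (A : ZXClass 1 3) (B : ZXClass 3 1) : (s ⊠ A) ⨟ B = s ⊠ (A ⨟ B) := by
  rw [scalar_par_seq_left, empty_par, cast_id]
/-- Bookkeeping mover (scalars / associativity of `⊗`). [cite: JeandelPerdrixVilmart2018, §2.2 (only topology matters; scalars)] -/
private theorem mv43 (A : ZXClass 1 4) (s : ZXClass 0 0) (B : ZXClass 4 3) : A ⨟ (s ⊠ B) = s ⊠ (A ⨟ B) := by
  rw [scalar_par_seq_right, empty_par, cast_id]
/-- Bookkeeping mover (scalars / associativity of `⊗`). [cite: JeandelPerdrixVilmart2018, §2.2 (only topology matters; scalars)] -/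
private theorem par22_scalar (E : ZXClass 2 2) (s : ZXClass 0 0) (R : ZXClass 2 1) : E ⊠ (s ⊠ R) = s ⊠ (E ⊠ R) := by
  rw [show E ⊠ (s ⊠ R) = (E ⊠ s) ⊠ R from (par_assoc' _ _ _).trans (cast_id _ _ _), ← scalar_par_two_two_comm]
  exact (par_assoc _ _ _).trans (cast_id _ _ _)

/-! ### Spider tools for the middle legs -/

/-- Unfusing the two middle outputs of `Z^{(1,4)}`. [cite: JeandelPerdrixVilmart2018, Fig. 1 (S1)] -/
theorem Z_one_four_eq_mid (p : ZMod 8) : mk (Z 1 4 p) = mk (Z 1 3 p) ⨟ (mk (wires 1) ⊠ (mk (Z 1 2 0) ⊠ mk (wires 1))) := by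
  rw [show mk (Z 1 3 p) = mk (Z 1 2 p) ⨟ (mk (wires 1) ⊠ mk (Z 1 2 0)) from by rw [Z_seq_par_Z 1 1 1 2 le_rfl, add_zero],
    seq_assoc, ← wires_par_seq, Z_seq_Z_par 1 1 1 2 le_rfl, add_zero, Z_seq_par_Z 1 1 1 3 le_rfl, add_zero]

/-- Fusing the two middle inputs of `Z^{(4,1)}`. [cite: JeandelPerdrixVilmart2018, Fig. 1 (S1)] -/
theorem Z_four_one_eq_mid : mk (Z 4 1 0) = (mk (wires 1) ⊠ (mk (Z 2 1 0) ⊠ mk (wires 1))) ⨟ mk (Z 3 1 0) := by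
  rw [show mk (Z 3 1 0) = (mk (wires 1) ⊠ mk (Z 2 1 0)) ⨟ mk (Z 2 1 0) from by rw [par_Z_seq_Z 1 2 1 1 le_rfl, add_zero],
    ← seq_assoc, ← wires_par_seq, Z_par_seq_Z 2 1 1 1 le_rfl, add_zero, par_Z_seq_Z 1 3 1 1 le_rfl, add_zero]

/-- A green effect on the middle output of `Z^{(1,3)}` removes it. [cite: JeandelPerdrixVilmart2018, Fig. 1 (S1)] -/
theorem Z_one_three_mid_effect (p : ZMod 8) : mk (Z 1 3 p) ⨟ (mk (wires 1) ⊠ (mk (Z 1 0 0) ⊠ mk (wires 1))) = mk (Z 1 2 p) := by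
  rw [show mk (Z 1 3 p) = mk (Z 1 2 p) ⨟ (mk (wires 1) ⊠ mk (Z 1 2 0)) from by rw [Z_seq_par_Z 1 1 1 2 le_rfl, add_zero],
    seq_assoc, ← wires_par_seq, Z_seq_Z_par 1 1 1 0 le_rfl, add_zero, Z_one_one, wires_par_wires, seq_id]

/-- A green state into the middle input of `Z^{(3,1)}` is absorbed. [cite: JeandelPerdrixVilmart2018, Fig. 1 (S1)] -/
theorem mid_state_seq_Z_three_one : (mk (wires 1) ⊠ (mk (Z 0 1 0) ⊠ mk (wires 1))) ⨟ mk (Z 3 1 0) = mk (Z 2 1 0) := by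
  rw [show mk (Z 3 1 0) = (mk (wires 1) ⊠ mk (Z 2 1 0)) ⨟ mk (Z 2 1 0) from by rw [par_Z_seq_Z 1 2 1 1 le_rfl, add_zero],
    ← seq_assoc, ← wires_par_seq, Z_par_seq_Z 0 1 1 1 le_rfl, add_zero, Z_one_one, wires_par_wires, id_seq]

/-- **The trivial pair**: two opposite leaf nodes in parallel between a copy and a merge disconnect,
`Z^{(1,2)} ⨾ (xLeafL 0 α ⊗ xLeafL 0 (-α)) ⨾ Z^{(2,1)} = 1/√2 ⊗ 1/√2 ⊗ (Z^{(1,0)} ⨾ Z^{(0,1)})`. [cite: JeandelPerdrixVilmart2018, Fig. 1 (B2), (B1)] -/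
theorem split_leafPair_merge (a : ZMod 8) :
    mk (Z 1 2 0) ⨟ (mk (xLeafL 0 a) ⊠ mk (xLeafL 0 (-a))) ⨟ mk (Z 2 1 0) = mk invSqrtTwo ⊠ (mk invSqrtTwo ⊠ (mk (Z 1 0 0) ⨟ mk (Z 0 1 0))) := by
  refine cancel_sqrt_two_left ?_
  rw [leafy_four_cycle, add_neg_cancel, xLeafL_zero_zero, sqrt_two_par_invSqrtTwo_par_one]

/-- Bookkeeping mover (scalars / associativity of `⊗`). [cite: JeandelPerdrixVilmart2018, §2.2 (only topology matters; scalars)] -/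
private theorem parL_scalar (A : ZXClass 1 1) (s : ZXClass 0 0) (B : ZXClass 3 2) : A ⊠ (s ⊠ B) = s ⊠ (A ⊠ B) := by
  rw [show A ⊠ (s ⊠ B) = (A ⊠ s) ⊠ B from (par_assoc' _ _ _).trans (cast_id _ _ _), ← scalar_par_one_comm]
  exact (par_assoc _ _ _).trans (cast_id _ _ _)
/-- Bookkeeping mover (scalars / associativity of `⊗`). [cite: JeandelPerdrixVilmart2018, §2.2 (only topology matters; scalars)] -/
private theorem one_scalar_par (s : ZXClass 0 0) (X : ZXClass 1 1) (B : ZXClass 2 1) : (s ⊠ X) ⊠ B = s ⊠ (X ⊠ B) :=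
  (par_assoc _ _ _).trans (cast_id _ _ _)
/-- Bookkeeping mover (scalars / associativity of `⊗`). [cite: JeandelPerdrixVilmart2018, §2.2 (only topology matters; scalars)] -/
private theorem mv24 (A : ZXClass 2 4) (s : ZXClass 0 0) (B : ZXClass 4 3) : A ⨟ (s ⊠ B) = s ⊠ (A ⨟ B) := by
  rw [scalar_par_seq_right, empty_par, cast_id]
/-- Bookkeeping mover (scalars / associativity of `⊗`). [cite: JeandelPerdrixVilmart2018, §2.2 (only topology matters; scalars)] -/
private theorem mv23 (s : ZXClass 0 0) (A : ZXClass 2 3) (B : ZXClass 3 1) : (s ⊠ A) ⨟ B = s ⊠ (A ⨟ B) := by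
  rw [scalar_par_seq_left, empty_par, cast_id]
/-- Bookkeeping mover (scalars / associativity of `⊗`). [cite: JeandelPerdrixVilmart2018, §2.2 (only topology matters; scalars)] -/
private theorem mv43s (s : ZXClass 0 0) (A : ZXClass 4 3) (B : ZXClass 3 1) : (s ⊠ A) ⨟ B = s ⊠ (A ⨟ B) := by
  rw [scalar_par_seq_left, empty_par, cast_id]
/-- Bookkeeping mover (scalars / associativity of `⊗`). [cite: JeandelPerdrixVilmart2018, §2.2 (only topology matters; scalars)] -/
private theorem mv24s (A : ZXClass 2 4) (s : ZXClass 0 0) (B : ZXClass 4 1) : A ⨟ (s ⊠ B) = s ⊠ (A ⨟ B) := by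
  rw [scalar_par_seq_right, empty_par, cast_id]

/-- **Stage S1, core**: the trivial pair of leaves `xLeafL 0 α`, `xLeafL 0 (-α)` between the `(2α+π)`-node and the
final merge is removed. [cite: JeandelPerdrixVilmart2018, Fig. 1 (B1), (B2), (S1)] -/
theorem controlAlpha_stage1_core (a : ZMod 8) :
    (mk (Z 1 4 (2 * a + 4)) ⊠ mk (wires 1)) ⨟ ((P₁ ⊠ mk (xLeafL 0 a)) ⊠ (mk (xLeafL 0 (-a)) ⊠ ((mk hBox ⊠ mk (wires 1)) ⨟ mk (Z 2 1 (-1)) ⨟ mk (xLeafL 4 1)))) ⨟ mk (Z 4 1 0) =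
      mk invSqrtTwo ⊠ (mk invSqrtTwo ⊠ ((mk (Z 1 2 (2 * a + 4)) ⊠ mk (wires 1)) ⨟ (P₁ ⊠ ((mk hBox ⊠ mk (wires 1)) ⨟ mk (Z 2 1 (-1)) ⨟ mk (xLeafL 4 1))) ⨟ mk (Z 2 1 0))) := by
  have hM : ((mk (wires 1) ⊠ (mk (Z 1 2 0) ⊠ mk (wires 1))) ⊠ mk (wires 1)) ⨟ ((P₁ ⊠ mk (xLeafL 0 a)) ⊠ (mk (xLeafL 0 (-a)) ⊠ ((mk hBox ⊠ mk (wires 1)) ⨟ mk (Z 2 1 (-1)) ⨟ mk (xLeafL 4 1)))) ⨟ (mk (wires 1) ⊠ (mk (Z 2 1 0) ⊠ mk (wires 1))) =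
      mk invSqrtTwo ⊠ (mk invSqrtTwo ⊠ (P₁ ⊠ ((mk (Z 1 0 0) ⨟ mk (Z 0 1 0)) ⊠ ((mk hBox ⊠ mk (wires 1)) ⨟ mk (Z 2 1 (-1)) ⨟ mk (xLeafL 4 1))))) := by
    rw [show (mk (wires 1) ⊠ (mk (Z 1 2 0) ⊠ mk (wires 1))) ⊠ mk (wires 1) = mk (wires 1) ⊠ (mk (Z 1 2 0) ⊠ mk (wires 2)) from by
        rw [← wires_par_wires 1 1, show mk (Z 1 2 0) ⊠ (mk (wires 1) ⊠ mk (wires 1)) = (mk (Z 1 2 0) ⊠ mk (wires 1)) ⊠ mk (wires 1) from (par_assoc' _ _ _).trans (cast_id _ _ _)]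
        exact (par_assoc _ _ _).trans (cast_id _ _ _),
      show (P₁ ⊠ mk (xLeafL 0 a)) ⊠ (mk (xLeafL 0 (-a)) ⊠ ((mk hBox ⊠ mk (wires 1)) ⨟ mk (Z 2 1 (-1)) ⨟ mk (xLeafL 4 1))) = P₁ ⊠ ((mk (xLeafL 0 a) ⊠ mk (xLeafL 0 (-a))) ⊠ ((mk hBox ⊠ mk (wires 1)) ⨟ mk (Z 2 1 (-1)) ⨟ mk (xLeafL 4 1))) from by
        rw [show (mk (xLeafL 0 a) ⊠ mk (xLeafL 0 (-a))) ⊠ ((mk hBox ⊠ mk (wires 1)) ⨟ mk (Z 2 1 (-1)) ⨟ mk (xLeafL 4 1)) = mk (xLeafL 0 a) ⊠ (mk (xLeafL 0 (-a)) ⊠ ((mk hBox ⊠ mk (wires 1)) ⨟ mk (Z 2 1 (-1)) ⨟ mk (xLeafL 4 1))) from (par_assoc _ _ _).trans (cast_id _ _ _)]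
        exact (par_assoc _ _ _).trans (cast_id _ _ _),
      interchange, id_seq, interchange, seq_id, interchange, id_seq, interchange, seq_id, split_leafPair_merge,
      one_scalar_par, one_scalar_par, parL_scalar, parL_scalar]
  rw [Z_one_four_eq_mid, seq_par_wires, Z_four_one_eq_mid, seq_assoc, seq_assoc, ← seq_assoc _ ((P₁ ⊠ mk (xLeafL 0 a)) ⊠ (mk (xLeafL 0 (-a)) ⊠ ((mk hBox ⊠ mk (wires 1)) ⨟ mk (Z 2 1 (-1)) ⨟ mk (xLeafL 4 1)))),
    ← seq_assoc _ (mk (wires 1) ⊠ (mk (Z 2 1 0) ⊠ mk (wires 1))), hM, mv43s, mv43s, mv24s, mv24s,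
    show (mk (Z 1 0 0) ⨟ mk (Z 0 1 0)) ⊠ ((mk hBox ⊠ mk (wires 1)) ⨟ mk (Z 2 1 (-1)) ⨟ mk (xLeafL 4 1)) = (mk (Z 1 0 0) ⊠ mk (wires 2)) ⨟ (mk (Z 0 1 0) ⊠ ((mk hBox ⊠ mk (wires 1)) ⨟ mk (Z 2 1 (-1)) ⨟ mk (xLeafL 4 1))) from by rw [interchange, id_seq],
    show P₁ ⊠ ((mk (Z 1 0 0) ⊠ mk (wires 2)) ⨟ (mk (Z 0 1 0) ⊠ ((mk hBox ⊠ mk (wires 1)) ⨟ mk (Z 2 1 (-1)) ⨟ mk (xLeafL 4 1)))) = (mk (wires 1) ⊠ (mk (Z 1 0 0) ⊠ mk (wires 2))) ⨟ (P₁ ⊠ (mk (Z 0 1 0) ⊠ ((mk hBox ⊠ mk (wires 1)) ⨟ mk (Z 2 1 (-1)) ⨟ mk (xLeafL 4 1)))) from by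
      rw [eq_comm, interchange, id_seq],
    seq_assoc (mk (wires 1) ⊠ (mk (Z 1 0 0) ⊠ mk (wires 2))) _ (mk (Z 3 1 0)), ← seq_assoc (mk (Z 1 3 (2 * a + 4)) ⊠ mk (wires 1)) (mk (wires 1) ⊠ (mk (Z 1 0 0) ⊠ mk (wires 2))),
    show (mk (Z 1 3 (2 * a + 4)) ⊠ mk (wires 1)) ⨟ (mk (wires 1) ⊠ (mk (Z 1 0 0) ⊠ mk (wires 2))) = mk (Z 1 2 (2 * a + 4)) ⊠ mk (wires 1) from by
      rw [← wires_par_wires 1 1, show mk (Z 1 0 0) ⊠ (mk (wires 1) ⊠ mk (wires 1)) = (mk (Z 1 0 0) ⊠ mk (wires 1)) ⊠ mk (wires 1) from (par_assoc' _ _ _).trans (cast_id _ _ _),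
        show mk (wires 1) ⊠ ((mk (Z 1 0 0) ⊠ mk (wires 1)) ⊠ mk (wires 1)) = (mk (wires 1) ⊠ (mk (Z 1 0 0) ⊠ mk (wires 1))) ⊠ mk (wires 1) from (par_assoc' _ _ _).trans (cast_id _ _ _),
        ← seq_par_wires, Z_one_three_mid_effect],
    show P₁ ⊠ (mk (Z 0 1 0) ⊠ ((mk hBox ⊠ mk (wires 1)) ⨟ mk (Z 2 1 (-1)) ⨟ mk (xLeafL 4 1))) = (P₁ ⊠ ((mk hBox ⊠ mk (wires 1)) ⨟ mk (Z 2 1 (-1)) ⨟ mk (xLeafL 4 1))) ⨟ ((mk (wires 1) ⊠ mk (Z 0 1 0)) ⊠ mk (wires 1)) from by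
      rw [show P₁ ⊠ (mk (Z 0 1 0) ⊠ ((mk hBox ⊠ mk (wires 1)) ⨟ mk (Z 2 1 (-1)) ⨟ mk (xLeafL 4 1))) = (P₁ ⊠ mk (Z 0 1 0)) ⊠ ((mk hBox ⊠ mk (wires 1)) ⨟ mk (Z 2 1 (-1)) ⨟ mk (xLeafL 4 1)) from (par_assoc' _ _ _).trans (cast_id _ _ _),
        par_eq_seq_left P₁ (mk (Z 0 1 0)), par_empty, interchange, seq_id],
    seq_assoc _ ((mk (wires 1) ⊠ mk (Z 0 1 0)) ⊠ mk (wires 1)) (mk (Z 3 1 0)),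
    show ((mk (wires 1) ⊠ mk (Z 0 1 0)) ⊠ mk (wires 1)) ⨟ mk (Z 3 1 0) = mk (Z 2 1 0) from by
      rw [show (mk (wires 1) ⊠ mk (Z 0 1 0)) ⊠ mk (wires 1) = mk (wires 1) ⊠ (mk (Z 0 1 0) ⊠ mk (wires 1)) from (par_assoc _ _ _).trans (cast_id _ _ _), mid_state_seq_Z_three_one],
    ← seq_assoc]

/-- Bookkeeping mover (scalars / associativity of `⊗`). [cite: JeandelPerdrixVilmart2018, §2.2 (only topology matters; scalars)] -/
private theorem mv22s (A : ZXClass 2 2) (s : ZXClass 0 0) (B : ZXClass 2 1) : A ⨟ (s ⊠ B) = s ⊠ (A ⨟ B) := by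
  rw [scalar_par_seq_right, empty_par, cast_id]
/-- Bookkeeping mover (scalars / associativity of `⊗`). [cite: JeandelPerdrixVilmart2018, §2.2 (only topology matters; scalars)] -/
private theorem mv12s (A : ZXClass 1 2) (s : ZXClass 0 0) (B : ZXClass 2 1) : A ⨟ (s ⊠ B) = s ⊠ (A ⨟ B) := by
  rw [scalar_par_seq_right, empty_par, cast_id]

/-- The two tails `P₁ ⊗ Q` of stage `E4b`, layered. [cite: JeandelPerdrixVilmart2018, Appendix (proof figures)] -/
private theorem P1_par_Q :
    P₁ ⊠ ((mk hBox ⊠ mk (wires 1)) ⨟ mk (Z 2 1 (-1)) ⨟ mk (xLeafL 4 1)) = ((mk hBox ⊠ mk hBox) ⊠ mk (wires 1)) ⨟ (mk (wires 1) ⊠ mk (Z 2 1 (-1))) ⨟ ((mk (Z 1 1 (-1)) ⨟ mk (xLeafL 0 1)) ⊠ mk (xLeafL 4 1)) := by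
  rw [seq_assoc (mk hBox) (mk (Z 1 1 (-1))) (mk (xLeafL 0 1)), seq_assoc (mk hBox ⊠ mk (wires 1)) (mk (Z 2 1 (-1))) (mk (xLeafL 4 1)), ← interchange,
    show mk hBox ⊠ (mk hBox ⊠ mk (wires 1)) = (mk hBox ⊠ mk hBox) ⊠ mk (wires 1) from (par_assoc' _ _ _).trans (cast_id _ _ _),
    show (mk (Z 1 1 (-1)) ⨟ mk (xLeafL 0 1)) ⊠ (mk (Z 2 1 (-1)) ⨟ mk (xLeafL 4 1)) = (mk (wires 1) ⊠ mk (Z 2 1 (-1))) ⨟ ((mk (Z 1 1 (-1)) ⨟ mk (xLeafL 0 1)) ⊠ mk (xLeafL 4 1)) from by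
      rw [eq_comm, interchange, id_seq], seq_assoc]

/-- **Stage S1** of `control-alpha-with-triangles`: `E4L = 1/√2 ⊗ 1/√2 ⊗ E4b` (unfusing the `(2α+π)`-node and
inserting the trivial pair of leaves, read backwards). [cite: JeandelPerdrixVilmart2018, Fig. 1 (B1), (B2), (S1)] -/
theorem controlAlpha_stage1 (a : ZMod 8) :
    PRE ⨟ (mk (Z 1 3 (a + 4)) ⊠ mk (wires 1)) ⨟ ((P₁ ⊠ mk (xLeafL 0 a)) ⊠ BLK[a]) ⨟ mk (Z 3 1 0) =
      mk invSqrtTwo ⊠ (mk invSqrtTwo ⊠ (PRE ⨟ (mk (Z 1 2 (2 * a + 4)) ⊠ mk (wires 1)) ⨟ ((mk hBox ⊠ mk hBox) ⊠ mk (wires 1)) ⨟ (mk (wires 1) ⊠ mk (Z 2 1 (-1))) ⨟ ((mk (Z 1 1 (-1)) ⨟ mk (xLeafL 0 1)) ⊠ mk (xLeafL 4 1)) ⨟ mk (Z 2 1 0))) := by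
  have h1 : (P₁ ⊠ mk (xLeafL 0 a)) ⊠ BLK[a] = (mk (wires 2) ⊠ (mk (Z 1 2 a) ⊠ mk (wires 1))) ⨟ ((P₁ ⊠ mk (xLeafL 0 a)) ⊠ (mk (xLeafL 0 (-a)) ⊠ ((mk hBox ⊠ mk (wires 1)) ⨟ mk (Z 2 1 (-1)) ⨟ mk (xLeafL 4 1)))) ⨟ (mk (wires 2) ⊠ mk (Z 2 1 0)) := by
    rw [eq_comm, interchange, id_seq, interchange, seq_id, seq_assoc (mk (Z 1 2 a) ⊠ mk (wires 1))]
  have h2 : (mk (Z 1 3 (a + 4)) ⊠ mk (wires 1)) ⨟ (mk (wires 2) ⊠ (mk (Z 1 2 a) ⊠ mk (wires 1))) = mk (Z 1 4 (2 * a + 4)) ⊠ mk (wires 1) := by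
    rw [show mk (wires 2) ⊠ (mk (Z 1 2 a) ⊠ mk (wires 1)) = (mk (wires 2) ⊠ mk (Z 1 2 a)) ⊠ mk (wires 1) from (par_assoc' _ _ _).trans (cast_id _ _ _), ← seq_par_wires,
      Z_seq_par_Z 1 2 1 2 le_rfl, show a + 4 + a = 2 * a + 4 from by ring]
  have h3 : (mk (wires 2) ⊠ mk (Z 2 1 0)) ⨟ mk (Z 3 1 0) = mk (Z 4 1 0) := by
    rw [par_Z_seq_Z 2 2 1 1 le_rfl, add_zero]
  rw [h1, seq_assoc PRE (mk (Z 1 3 (a + 4)) ⊠ mk (wires 1)) (((mk (wires 2) ⊠ (mk (Z 1 2 a) ⊠ mk (wires 1))) ⨟ ((P₁ ⊠ mk (xLeafL 0 a)) ⊠ (mk (xLeafL 0 (-a)) ⊠ ((mk hBox ⊠ mk (wires 1)) ⨟ mk (Z 2 1 (-1)) ⨟ mk (xLeafL 4 1))))) ⨟ (mk (wires 2) ⊠ mk (Z 2 1 0))), ← seq_assoc (mk (Z 1 3 (a + 4)) ⊠ mk (wires 1)) ((mk (wires 2) ⊠ (mk (Z 1 2 a) ⊠ mk (wires 1))) ⨟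 ((P₁ ⊠ mk (xLeafL 0 a)) ⊠ (mk (xLeafL 0 (-a)) ⊠ ((mk hBox ⊠ mk (wires 1)) ⨟ mk (Z 2 1 (-1)) ⨟ mk (xLeafL 4 1))))) (mk (wires 2) ⊠ mk (Z 2 1 0)),
    ← seq_assoc (mk (Z 1 3 (a + 4)) ⊠ mk (wires 1)) (mk (wires 2) ⊠ (mk (Z 1 2 a) ⊠ mk (wires 1))) ((P₁ ⊠ mk (xLeafL 0 a)) ⊠ (mk (xLeafL 0 (-a)) ⊠ ((mk hBox ⊠ mk (wires 1)) ⨟ mk (Z 2 1 (-1)) ⨟ mk (xLeafL 4 1)))), h2, seq_assoc PRE _ (mk (Z 3 1 0)), seq_assoc ((mk (Z 1 4 (2 * a + 4)) ⊠ mk (wires 1)) ⨟ ((P₁ ⊠ mk (xLeafL 0 a)) ⊠ (mk (xLeafL 0 (-a)) ⊠ ((mk hBox ⊠ mk (wires 1)) ⨟ mk (Z 2 1 (-1)) ⨟ mk (xLeafL 4 1))))) (mk (wires 2) ⊠ mk (Z 2 1 0)) (mk (Z 3 1 0)),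
    h3, controlAlpha_stage1_core, mv12s, mv12s, P1_par_Q]
  simp only [seq_assoc]

/-- **Stage S2** (the first (C1) step of `control-alpha-with-triangles`, in context):
`db 4 α ⊗ E4L = db 4 (π/4) ⊗ E5L`. [cite: JeandelPerdrixVilmart2018, Appendix Lemma 17] -/
theorem controlAlpha_stage2 (a : ZMod 8) :
    mk (dumbbell 4 a) ⊠ (PRE ⨟ (mk (Z 1 3 (a + 4)) ⊠ mk (wires 1)) ⨟ ((P₁ ⊠ mk (xLeafL 0 a)) ⊠ BLK[a]) ⨟ mk (Z 3 1 0)) =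
      mk (dumbbell 4 1) ⊠ (PRE ⨟ (mk (Z 1 3 (a + 4)) ⊠ mk (wires 1)) ⨟ ((P₁ ⊠ mk (xLeafL 0 a)) ⊠ RBLK[a]) ⨟ mk (Z 3 1 0)) := by
  rw [← mv13, ← mv43, ← par22_scalar, c1_block, par22_scalar, mv43, mv13]

/-! ### Stage S3: from the (C1) output to the endgame form -/

/-- **Stage S3c**: extracting the `π` of the `(α+π)`-node through its input Hadamard and recolouring its
`0`-part red: `H ⨾ Z^{(1,3)}(α+π) ⨾ (𝕀₂ ⊗ (H ⨾ Z^{(1,2)}(-π/4))) = X^{(1,2)}(π) ⨾ ((H ⨾ Z^{(1,2)}(α)) ⊗ Z^{(1,2)}(-π/4))`.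
[cite: JeandelPerdrixVilmart2018, Fig. 1 (S1), (H), (K)] -/
theorem controlAlpha_stage3c (a : ZMod 8) :
    mk hBox ⨟ mk (Z 1 3 (a + 4)) ⨟ (mk (wires 2) ⊠ (mk hBox ⨟ mk (Z 1 2 (-1)))) = mk (X 1 2 4) ⨟ ((mk hBox ⨟ mk (Z 1 2 a)) ⊠ mk (Z 1 2 (-1))) := by
  rw [show mk (Z 1 3 (a + 4)) = mk (Z 1 1 4) ⨟ (mk (Z 1 2 0) ⨟ ((mk hBox ⨟ mk hBox ⨟ mk (Z 1 2 a)) ⊠ mk (wires 1))) from by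
      rw [hBox_seq_hBox, id_seq, Z_seq_Z_par 1 1 1 2 le_rfl, add_zero, Z_seq_Z 1 1 3 le_rfl, add_comm],
    show (mk hBox ⨟ mk hBox ⨟ mk (Z 1 2 a)) ⊠ mk (wires 1) = (mk hBox ⊠ mk (wires 1)) ⨟ (mk (wires 1) ⊠ mk hBox) ⨟ (mk (wires 1) ⊠ mk hBox) ⨟ ((mk hBox ⨟ mk (Z 1 2 a)) ⊠ mk (wires 1)) from by
      rw [eq_comm]; rw [interchange, seq_id, id_seq, interchange, seq_id, hBox_seq_hBox, interchange, id_seq, ← seq_assoc, hBox_seq_hBox],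
    wires_par_seq]
  simp only [seq_assoc]
  rw [← seq_assoc (mk hBox) (mk (Z 1 1 4)), ← X_phase_seq_hBox, seq_assoc (mk (X 1 1 4)) (mk hBox),
    ← seq_assoc (mk hBox ⊠ mk (wires 1)) (mk (wires 1) ⊠ mk hBox) ((mk (wires 1) ⊠ mk hBox) ⨟ (((mk hBox ⨟ mk (Z 1 2 a)) ⊠ mk (wires 1)) ⨟ ((mk (wires 2) ⊠ mk hBox) ⨟ (mk (wires 2) ⊠ mk (Z 1 2 (-1)))))),
    show (mk hBox ⊠ mk (wires 1)) ⨟ (mk (wires 1) ⊠ mk hBox) = mk hBox ⊠ mk hBox from by rw [interchange, seq_id, id_seq],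
    ← seq_assoc (mk (Z 1 2 0)) (mk hBox ⊠ mk hBox) ((mk (wires 1) ⊠ mk hBox) ⨟ (((mk hBox ⨟ mk (Z 1 2 a)) ⊠ mk (wires 1)) ⨟ ((mk (wires 2) ⊠ mk hBox) ⨟ (mk (wires 2) ⊠ mk (Z 1 2 (-1)))))), ← seq_assoc (mk hBox) (mk (Z 1 2 0) ⨟ (mk hBox ⊠ mk hBox)) ((mk (wires 1) ⊠ mk hBox) ⨟ (((mk hBox ⨟ mk (Z 1 2 a)) ⊠ mk (wires 1)) ⨟ ((mk (wires 2) ⊠ mk hBox) ⨟ (mk (wires 2) ⊠ mk (Z 1 2 (-1)))))),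
    show mk hBox ⨟ (mk (Z 1 2 0) ⨟ (mk hBox ⊠ mk hBox)) = mk (X 1 2 0) from by rw [← seq_assoc, ← X_split_eq],
    ← seq_assoc (mk (X 1 1 4)) (mk (X 1 2 0)) ((mk (wires 1) ⊠ mk hBox) ⨟ (((mk hBox ⨟ mk (Z 1 2 a)) ⊠ mk (wires 1)) ⨟ ((mk (wires 2) ⊠ mk hBox) ⨟ (mk (wires 2) ⊠ mk (Z 1 2 (-1)))))), X_seq_X 1 1 2 le_rfl, add_zero,
    ← seq_assoc (mk (wires 1) ⊠ mk hBox) ((mk hBox ⨟ mk (Z 1 2 a)) ⊠ mk (wires 1)), interchange, id_seq, seq_id,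
    ← seq_assoc _ (mk (wires 2) ⊠ mk hBox) (mk (wires 2) ⊠ mk (Z 1 2 (-1))), interchange, seq_id, hBox_seq_hBox, interchange, seq_id, id_seq]

/-- **Stage S3ab**: the Hadamards on the second wire cancel and the `α`-split fuses into the top split.
[cite: JeandelPerdrixVilmart2018, Fig. 1 (S1), §2.2] -/
theorem controlAlpha_stage3ab (a : ZMod 8) :
    PRE ⨟ (mk (Z 1 3 (a + 4)) ⊠ mk (wires 1)) ⨟ ((P₁ ⊠ mk (xLeafL 0 a)) ⊠ RBLK[a]) ⨟ mk (Z 3 1 0) =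
      mk (Z 1 3 (a - 2)) ⨟ ((mk hBox ⨟ mk (Z 1 3 (a + 4)) ⨟ (mk (wires 2) ⊠ (mk hBox ⨟ mk (Z 1 2 (-1))))) ⊠ mk (wires 2)) ⨟ ((P₁ ⊠ mk (xLeafL 0 a)) ⊠ (HC₄ ⨟ (mk (xLeafL 0 (-1)) ⊠ mk (xLeafL 4 a)) ⨟ mk (Z 2 1 0))) ⨟ mk (Z 3 1 0) := by
  have h1 : RBLK[a] = ((mk hBox ⊠ mk hBox) ⨟ (mk (Z 1 2 (-1)) ⊠ mk (Z 1 2 a))) ⨟ (HC₄ ⨟ (mk (xLeafL 0 (-1)) ⊠ mk (xLeafL 4 a)) ⨟ mk (Z 2 1 0)) := by simp only [seq_assoc]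
  have h2 : (P₁ ⊠ mk (xLeafL 0 a)) ⊠ (((mk hBox ⊠ mk hBox) ⨟ (mk (Z 1 2 (-1)) ⊠ mk (Z 1 2 a))) ⨟ (HC₄ ⨟ (mk (xLeafL 0 (-1)) ⊠ mk (xLeafL 4 a)) ⨟ mk (Z 2 1 0))) = ((mk (wires 2) ⊠ (mk hBox ⊠ mk hBox)) ⨟ (mk (wires 2) ⊠ (mk (Z 1 2 (-1)) ⊠ mk (Z 1 2 a)))) ⨟ ((P₁ ⊠ mk (xLeafL 0 a)) ⊠ (HC₄ ⨟ (mk (xLeafL 0 (-1)) ⊠ mk (xLeafL 4 a)) ⨟ mk (Z 2 1 0))) := by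
    rw [← wires_par_seq, eq_comm, interchange, id_seq]
  have h3 : (mk (Z 1 3 (a + 4)) ⊠ mk (wires 1)) ⨟ (mk (wires 2) ⊠ (mk hBox ⊠ mk hBox)) = (mk (Z 1 3 (a + 4)) ⨟ (mk (wires 2) ⊠ mk hBox)) ⊠ mk hBox := by
    rw [show mk (wires 2) ⊠ (mk hBox ⊠ mk hBox) = (mk (wires 2) ⊠ mk hBox) ⊠ mk hBox from (par_assoc' _ _ _).trans (cast_id _ _ _), interchange, id_seq]
  have h4 : (mk hBox ⊠ mk hBox) ⨟ ((mk (Z 1 3 (a + 4)) ⨟ (mk (wires 2) ⊠ mk hBox)) ⊠ mk hBox) = (mk hBox ⨟ mk (Z 1 3 (a + 4)) ⨟ (mk (wires 2) ⊠ mk hBox)) ⊠ mk (wires 1) := by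
    rw [interchange, hBox_seq_hBox, seq_assoc]
  have h5 : ((mk hBox ⨟ mk (Z 1 3 (a + 4)) ⨟ (mk (wires 2) ⊠ mk hBox)) ⊠ mk (wires 1)) ⨟ (mk (wires 2) ⊠ (mk (Z 1 2 (-1)) ⊠ mk (Z 1 2 a))) = (mk hBox ⨟ mk (Z 1 3 (a + 4)) ⨟ (mk (wires 2) ⊠ (mk hBox ⨟ mk (Z 1 2 (-1))))) ⊠ mk (Z 1 2 a) := by
    rw [show mk (wires 2) ⊠ (mk (Z 1 2 (-1)) ⊠ mk (Z 1 2 a)) = (mk (wires 2) ⊠ mk (Z 1 2 (-1))) ⊠ mk (Z 1 2 a) from (par_assoc' _ _ _).trans (cast_id _ _ _), interchange, id_seq, seq_assoc, ← wires_par_seq]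
  have h6 : (mk hBox ⨟ mk (Z 1 3 (a + 4)) ⨟ (mk (wires 2) ⊠ (mk hBox ⨟ mk (Z 1 2 (-1))))) ⊠ mk (Z 1 2 a) = (mk (wires 1) ⊠ mk (Z 1 2 a)) ⨟ ((mk hBox ⨟ mk (Z 1 3 (a + 4)) ⨟ (mk (wires 2) ⊠ (mk hBox ⨟ mk (Z 1 2 (-1))))) ⊠ mk (wires 2)) := by
    rw [eq_comm, interchange, id_seq, seq_id]
  rw [h1, h2, seq_assoc PRE, ← seq_assoc (mk (Z 1 3 (a + 4)) ⊠ mk (wires 1)), ← seq_assoc (mk (Z 1 3 (a + 4)) ⊠ mk (wires 1)), h3,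
    ← seq_assoc PRE, ← seq_assoc PRE, seq_assoc (mk (Z 1 1 (-2)) ⨟ mk (Z 1 2 0)) (mk hBox ⊠ mk hBox), h4, seq_assoc (mk (Z 1 1 (-2)) ⨟ mk (Z 1 2 0)), h5, h6,
    ← seq_assoc (mk (Z 1 1 (-2)) ⨟ mk (Z 1 2 0)), seq_assoc (mk (Z 1 1 (-2))) (mk (Z 1 2 0)), Z_seq_par_Z 1 1 1 2 le_rfl, zero_add, Z_seq_Z 1 1 3 le_rfl,
    show (-2 : ZMod 8) + a = a - 2 from by ring]

/-- The split bent into the hedge, mirrored: `(Z^{(1,2)}(-π/4) ⊗ 𝕀) ⨾ (𝕀 ⊗ H∪ᵗ) = (𝕀 ⊗ H) ⨾ Z^{(2,1)}(-π/4)`. [cite: JeandelPerdrixVilmart2018, §2.2] -/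
theorem Z_split_par_seq_par_hcap :
    (mk (Z 1 2 (-1)) ⊠ mk (wires 1)) ⨟ (mk (wires 1) ⊠ ((mk hBox ⊠ mk (wires 1)) ⨟ mk cap)) = (mk (wires 1) ⊠ mk hBox) ⨟ mk (Z 2 1 (-1)) := by
  rw [hBox_par_seq_cap_comm, wires_par_seq, ← seq_assoc,
    show mk (wires 1) ⊠ (mk (wires 1) ⊠ mk hBox) = mk (wires 2) ⊠ mk hBox from by rw [← wires_par_wires 1 1]; exact (par_assoc' _ _ _).trans (cast_id _ _ _),
    show (mk (Z 1 2 (-1)) ⊠ mk (wires 1)) ⨟ (mk (wires 2) ⊠ mk hBox) = (mk (wires 1) ⊠ mk hBox) ⨟ (mk (Z 1 2 (-1)) ⊠ mk (wires 1)) from by rw [interchange, seq_id, id_seq, ← par_eq_seq_right],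
    seq_assoc, show mk (Z 1 2 (-1)) = mk (Z 1 1 (-1)) ⨟ mk (Z 1 2 0) from by rw [Z_seq_Z 1 1 2 le_rfl, add_zero], seq_par_wires, seq_assoc,
    split_par_seq_par_cap, Z_par_seq_Z 1 1 1 1 le_rfl, add_zero (-1 : ZMod 8)]

/-- **Stage S3d, key**: the triangle `top – X^{(1,2)}(π) – Z^{(1,2)}(-π/4)` closed by the bent hedge is the
(U)-redex `split_xpisplit_hBox_merge`. [cite: JeandelPerdrixVilmart2018, Fig. 1 (B2), (H), §2.2] -/
theorem controlAlpha_stage3d_key (a : ZMod 8) :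
    mk (Z 1 2 0) ⨟ ((mk (X 1 2 4) ⨟ ((mk hBox ⨟ mk (Z 1 2 a)) ⊠ mk (Z 1 2 (-1)))) ⊠ mk (wires 1)) ⨟ ((P₁ ⊠ mk (xLeafL 0 a)) ⊠ (mk (wires 1) ⊠ ((mk hBox ⊠ mk (wires 1)) ⨟ mk cap))) = mk (X 1 2 4) ⨟ (mk (Z 1 2 0) ⊠ mk (Z 1 2 0)) ⨟ HC₄ ⨟ ((mk hBox ⨟ mk (Z 1 2 a) ⨟ (P₁ ⊠ mk (xLeafL 0 a))) ⊠ mk (Z 1 1 (-1))) := by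
  have h1 : ((mk (X 1 2 4) ⨟ ((mk hBox ⨟ mk (Z 1 2 a)) ⊠ mk (Z 1 2 (-1)))) ⊠ mk (wires 1)) ⨟ ((P₁ ⊠ mk (xLeafL 0 a)) ⊠ (mk (wires 1) ⊠ ((mk hBox ⊠ mk (wires 1)) ⨟ mk cap))) = (mk (X 1 2 4) ⊠ mk (wires 1)) ⨟ ((mk hBox ⨟ mk (Z 1 2 a) ⨟ (P₁ ⊠ mk (xLeafL 0 a))) ⊠ ((mk (wires 1) ⊠ mk hBox) ⨟ mk (Z 2 1 (-1)))) := by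
    rw [seq_par_wires, seq_assoc, show ((mk hBox ⨟ mk (Z 1 2 a)) ⊠ mk (Z 1 2 (-1))) ⊠ mk (wires 1) = (mk hBox ⨟ mk (Z 1 2 a)) ⊠ (mk (Z 1 2 (-1)) ⊠ mk (wires 1)) from
      (par_assoc _ _ _).trans (cast_id _ _ _), interchange, Z_split_par_seq_par_hcap]
  have h2 : (mk hBox ⨟ mk (Z 1 2 a) ⨟ (P₁ ⊠ mk (xLeafL 0 a))) ⊠ ((mk (wires 1) ⊠ mk hBox) ⨟ mk (Z 2 1 (-1))) = (mk (wires 1) ⊠ (mk (wires 1) ⊠ mk hBox)) ⨟ (mk (wires 1) ⊠ mk (Z 2 1 0)) ⨟ (mk (wires 1) ⊠ mk (Z 1 1 (-1))) ⨟ ((mk hBox ⨟ mk (Z 1 2 a) ⨟ (P₁ ⊠ mk (xLeafL 0 a))) ⊠ mk (wires 1)) := by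
    rw [show mk (Z 2 1 (-1)) = mk (Z 2 1 0) ⨟ mk (Z 1 1 (-1)) from by rw [Z_seq_Z 2 1 1 le_rfl, zero_add],
      show (mk hBox ⨟ mk (Z 1 2 a) ⨟ (P₁ ⊠ mk (xLeafL 0 a))) ⊠ ((mk (wires 1) ⊠ mk hBox) ⨟ (mk (Z 2 1 0) ⨟ mk (Z 1 1 (-1)))) = (mk (wires 1) ⊠ ((mk (wires 1) ⊠ mk hBox) ⨟ (mk (Z 2 1 0) ⨟ mk (Z 1 1 (-1))))) ⨟ ((mk hBox ⨟ mk (Z 1 2 a) ⨟ (P₁ ⊠ mk (xLeafL 0 a))) ⊠ mk (wires 1)) from by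
        rw [eq_comm, interchange, id_seq, seq_id], wires_par_seq, wires_par_seq]
    simp only [seq_assoc]
  rw [seq_assoc (mk (Z 1 2 0)), h1, h2]
  simp only [← seq_assoc]
  rw [seq_assoc (mk (Z 1 2 0)) (mk (X 1 2 4) ⊠ mk (wires 1)) (mk (wires 1) ⊠ (mk (wires 1) ⊠ mk hBox)),
    show (mk (X 1 2 4) ⊠ mk (wires 1)) ⨟ (mk (wires 1) ⊠ (mk (wires 1) ⊠ mk hBox)) = mk (X 1 2 4) ⊠ mk hBox from by
      rw [show mk (wires 1) ⊠ (mk (wires 1) ⊠ mk hBox) = mk (wires 2) ⊠ mk hBox from by rw [← wires_par_wires 1 1]; exact (par_assoc' _ _ _).trans (cast_id _ _ _), interchange, seq_id, id_seq],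
    split_xpisplit_hBox_merge, seq_assoc _ (mk (wires 1) ⊠ mk (Z 1 1 (-1))) ((mk hBox ⨟ mk (Z 1 2 a) ⨟ (P₁ ⊠ mk (xLeafL 0 a))) ⊠ mk (wires 1)),
    show (mk (wires 1) ⊠ mk (Z 1 1 (-1))) ⨟ ((mk hBox ⨟ mk (Z 1 2 a) ⨟ (P₁ ⊠ mk (xLeafL 0 a))) ⊠ mk (wires 1)) = (mk hBox ⨟ mk (Z 1 2 a) ⨟ (P₁ ⊠ mk (xLeafL 0 a))) ⊠ mk (Z 1 1 (-1)) from by rw [interchange, id_seq, seq_id]]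

/-- **Stage S3d, junk step**: merging the two outputs of the `α`-split branch is the junk identity. [cite: JeandelPerdrixVilmart2018, Appendix Lemma 17] -/
theorem controlAlpha_stage3d_junk (a : ZMod 8) :
    (mk (X 1 2 4) ⨟ (mk (Z 1 2 0) ⊠ mk (Z 1 2 0)) ⨟ HC₄ ⨟ ((mk hBox ⨟ mk (Z 1 2 a) ⨟ (P₁ ⊠ mk (xLeafL 0 a))) ⊠ mk (Z 1 1 (-1)))) ⨟ (mk (Z 2 1 0) ⊠ mk (wires 1)) =
      mk invSqrtTwo ⊠ (mk (X 1 2 4) ⨟ (mk (Z 1 2 0) ⊠ mk (Z 1 2 0)) ⨟ HC₄ ⨟ ((mk (Z 1 1 (-1)) ⨟ mk (xLeafL 0 1) ⨟ mk (Z 1 1 a)) ⊠ mk (Z 1 1 (-1)))) := by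
  rw [seq_assoc _ ((mk hBox ⨟ mk (Z 1 2 a) ⨟ (P₁ ⊠ mk (xLeafL 0 a))) ⊠ mk (Z 1 1 (-1))), interchange, seq_id, junk, show ∀ (s : ZXClass 0 0) (A B : ZXClass 1 1), (s ⊠ A) ⊠ B = s ⊠ (A ⊠ B) from fun s A B => (par_assoc _ _ _).trans (cast_id _ _ _),
    show ∀ (A : ZXClass 1 2) (s : ZXClass 0 0) (B : ZXClass 2 2), A ⨟ (s ⊠ B) = s ⊠ (A ⨟ B) from fun A s B => by rw [scalar_par_seq_right, empty_par, cast_id]]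

/-- Bookkeeping mover (scalars / associativity of `⊗`). [cite: JeandelPerdrixVilmart2018, §2.2 (only topology matters; scalars)] -/
private theorem mv12_23 (A : ZXClass 1 2) (s : ZXClass 0 0) (B : ZXClass 2 3) : A ⨟ (s ⊠ B) = s ⊠ (A ⨟ B) := by
  rw [scalar_par_seq_right, empty_par, cast_id]
/-- Bookkeeping mover (scalars / associativity of `⊗`). [cite: JeandelPerdrixVilmart2018, §2.2 (only topology matters; scalars)] -/
private theorem mv23_32 (s : ZXClass 0 0) (A : ZXClass 2 3) (B : ZXClass 3 2) : (s ⊠ A) ⨟ B = s ⊠ (A ⨟ B) := by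
  rw [scalar_par_seq_left, empty_par, cast_id]
/-- Bookkeeping mover (scalars / associativity of `⊗`). [cite: JeandelPerdrixVilmart2018, §2.2 (only topology matters; scalars)] -/
private theorem mv12_22s (A : ZXClass 1 2) (s : ZXClass 0 0) (B : ZXClass 2 2) : A ⨟ (s ⊠ B) = s ⊠ (A ⨟ B) := by
  rw [scalar_par_seq_right, empty_par, cast_id]

/-- **Stage S3d** of `control-alpha-with-triangles`: the (U) step, the junk removal, and the regrouping onto the
endgame form, `F3 = 1/√2 ⊗ F4`. [cite: JeandelPerdrixVilmart2018, Appendix Lemma 17; Fig. 1] -/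
theorem controlAlpha_stage3d (a : ZMod 8) :
    mk (Z 1 3 (a - 2)) ⨟ ((mk (X 1 2 4) ⨟ ((mk hBox ⨟ mk (Z 1 2 a)) ⊠ mk (Z 1 2 (-1)))) ⊠ mk (wires 2)) ⨟ ((P₁ ⊠ mk (xLeafL 0 a)) ⊠ (HC₄ ⨟ (mk (xLeafL 0 (-1)) ⊠ mk (xLeafL 4 a)) ⨟ mk (Z 2 1 0))) ⨟ mk (Z 3 1 0) =
      mk invSqrtTwo ⊠ (mk (Z 1 2 (a - 2)) ⨟ ((mk (X 1 2 4) ⨟ (mk (Z 1 2 0) ⊠ mk (Z 1 2 0)) ⨟ HC₄ ⨟ ((mk (Z 1 1 (-1)) ⨟ mk (xLeafL 0 1) ⨟ mk (Z 1 1 a)) ⊠ (mk (Z 1 1 (-1)) ⨟ mk (xLeafL 0 (-1))))) ⊠ mk (xLeafL 4 a)) ⨟ mk (Z 3 1 0)) := by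
  have g1 : mk (Z 1 3 (a - 2)) = mk (Z 1 2 (a - 2)) ⨟ (mk (Z 1 2 0) ⊠ mk (wires 1)) := by rw [Z_seq_Z_par 1 1 1 2 le_rfl, zero_add]
  have g2 : (mk (Z 1 2 0) ⊠ mk (wires 1)) ⨟ ((mk (X 1 2 4) ⨟ ((mk hBox ⨟ mk (Z 1 2 a)) ⊠ mk (Z 1 2 (-1)))) ⊠ mk (wires 2)) = (mk (Z 1 2 0) ⨟ ((mk (X 1 2 4) ⨟ ((mk hBox ⨟ mk (Z 1 2 a)) ⊠ mk (Z 1 2 (-1)))) ⊠ mk (wires 1))) ⊠ mk (wires 1) := by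
    rw [← wires_par_wires 1 1, show (mk (X 1 2 4) ⨟ ((mk hBox ⨟ mk (Z 1 2 a)) ⊠ mk (Z 1 2 (-1)))) ⊠ (mk (wires 1) ⊠ mk (wires 1)) = ((mk (X 1 2 4) ⨟ ((mk hBox ⨟ mk (Z 1 2 a)) ⊠ mk (Z 1 2 (-1)))) ⊠ mk (wires 1)) ⊠ mk (wires 1) from (par_assoc' _ _ _).trans (cast_id _ _ _), ← seq_par_wires]
  have g3 : (P₁ ⊠ mk (xLeafL 0 a)) ⊠ (HC₄ ⨟ (mk (xLeafL 0 (-1)) ⊠ mk (xLeafL 4 a)) ⨟ mk (Z 2 1 0)) = ((((P₁ ⊠ mk (xLeafL 0 a)) ⊠ (mk (wires 1) ⊠ ((mk hBox ⊠ mk (wires 1)) ⨟ mk cap))) ⊠ mk (wires 1)) ⨟ (mk (wires 2) ⊠ ((mk (xLeafL 0 (-1)) ⊠ mk (xLeafL 4 a)) ⨟ mk (Z 2 1 0)))) := by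
    rw [show ((P₁ ⊠ mk (xLeafL 0 a)) ⊠ (mk (wires 1) ⊠ ((mk hBox ⊠ mk (wires 1)) ⨟ mk cap))) ⊠ mk (wires 1) = (P₁ ⊠ mk (xLeafL 0 a)) ⊠ HC₄ from (par_assoc _ _ _).trans (cast_id _ _ _), eq_comm, interchange, seq_id, ← seq_assoc HC₄ (mk (xLeafL 0 (-1)) ⊠ mk (xLeafL 4 a)) (mk (Z 2 1 0))]
  have g5 : ((mk (Z 1 2 0) ⨟ ((mk (X 1 2 4) ⨟ ((mk hBox ⨟ mk (Z 1 2 a)) ⊠ mk (Z 1 2 (-1)))) ⊠ mk (wires 1))) ⊠ mk (wires 1)) ⨟ ((((P₁ ⊠ mk (xLeafL 0 a)) ⊠ (mk (wires 1) ⊠ ((mk hBox ⊠ mk (wires 1)) ⨟ mk cap))) ⊠ mk (wires 1))) = (mk (X 1 2 4) ⨟ (mk (Z 1 2 0) ⊠ mk (Z 1 2 0)) ⨟ HC₄ ⨟ ((mk hBox ⨟ mk (Z 1 2 a) ⨟ (P₁ ⊠ mk (xLeafL 0 a))) ⊠ mk (Z 1 1 (-1)))) ⊠ mk (wires 1) :=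 by
    rw [← seq_par_wires, controlAlpha_stage3d_key]
  have g6 : mk (Z 3 1 0) = (mk (Z 2 1 0) ⊠ mk (wires 1)) ⨟ mk (Z 2 1 0) := by rw [Z_par_seq_Z 2 1 1 1 le_rfl, add_zero]
  have g7 : (mk (wires 2) ⊠ ((mk (xLeafL 0 (-1)) ⊠ mk (xLeafL 4 a)) ⨟ mk (Z 2 1 0))) ⨟ (mk (Z 2 1 0) ⊠ mk (wires 1)) = (mk (Z 2 1 0) ⊠ mk (wires 2)) ⨟ (mk (wires 1) ⊠ ((mk (xLeafL 0 (-1)) ⊠ mk (xLeafL 4 a)) ⨟ mk (Z 2 1 0))) := by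
    rw [interchange, interchange, id_seq, seq_id, id_seq, seq_id]
  have g8 : ((mk (X 1 2 4) ⨟ (mk (Z 1 2 0) ⊠ mk (Z 1 2 0)) ⨟ HC₄ ⨟ ((mk hBox ⨟ mk (Z 1 2 a) ⨟ (P₁ ⊠ mk (xLeafL 0 a))) ⊠ mk (Z 1 1 (-1)))) ⊠ mk (wires 1)) ⨟ (mk (Z 2 1 0) ⊠ mk (wires 2)) = mk invSqrtTwo ⊠ ((mk (X 1 2 4) ⨟ (mk (Z 1 2 0) ⊠ mk (Z 1 2 0)) ⨟ HC₄ ⨟ ((mk (Z 1 1 (-1)) ⨟ mk (xLeafL 0 1) ⨟ mk (Z 1 1 a)) ⊠ mk (Z 1 1 (-1)))) ⊠ mk (wires 1)) := by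
    rw [← wires_par_wires 1 1, show mk (Z 2 1 0) ⊠ (mk (wires 1) ⊠ mk (wires 1)) = (mk (Z 2 1 0) ⊠ mk (wires 1)) ⊠ mk (wires 1) from (par_assoc' _ _ _).trans (cast_id _ _ _), ← seq_par_wires,
      controlAlpha_stage3d_junk]
    exact (par_assoc _ _ _).trans (cast_id _ _ _)
  have g10 : ((mk (X 1 2 4) ⨟ (mk (Z 1 2 0) ⊠ mk (Z 1 2 0)) ⨟ HC₄ ⨟ ((mk (Z 1 1 (-1)) ⨟ mk (xLeafL 0 1) ⨟ mk (Z 1 1 a)) ⊠ mk (Z 1 1 (-1)))) ⊠ mk (wires 1)) ⨟ (mk (wires 1) ⊠ ((mk (xLeafL 0 (-1)) ⊠ mk (xLeafL 4 a)) ⨟ mk (Z 2 1 0))) = ((mk (X 1 2 4) ⨟ (mk (Z 1 2 0) ⊠ mk (Z 1 2 0)) ⨟ HC₄ ⨟ ((mk (Z 1 1 (-1)) ⨟ mk (xLeafL 0 1) ⨟ mk (Z 1 1 a)) ⊠ (mk (Z 1 1 (-1)) ⨟ mk (xLeafL 0 (-1))))) ⊠ mk (xLeafL 4 a)) ⨟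 (mk (wires 1) ⊠ mk (Z 2 1 0)) := by
    rw [show mk (wires 1) ⊠ ((mk (xLeafL 0 (-1)) ⊠ mk (xLeafL 4 a)) ⨟ mk (Z 2 1 0)) = (mk (wires 1) ⊠ (mk (xLeafL 0 (-1)) ⊠ mk (xLeafL 4 a))) ⨟ (mk (wires 1) ⊠ mk (Z 2 1 0)) from by rw [wires_par_seq], ← seq_assoc, show mk (wires 1) ⊠ (mk (xLeafL 0 (-1)) ⊠ mk (xLeafL 4 a)) = (mk (wires 1) ⊠ mk (xLeafL 0 (-1))) ⊠ mk (xLeafL 4 a) from (par_assoc' _ _ _).trans (cast_id _ _ _),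
      interchange, id_seq, seq_assoc _ ((mk (Z 1 1 (-1)) ⨟ mk (xLeafL 0 1) ⨟ mk (Z 1 1 a)) ⊠ mk (Z 1 1 (-1))) (mk (wires 1) ⊠ mk (xLeafL 0 (-1))), interchange, seq_id]
  rw [g1, seq_assoc (mk (Z 1 2 (a - 2))), g2, g3, seq_assoc (mk (Z 1 2 (a - 2))), ← seq_assoc ((mk (Z 1 2 0) ⨟ ((mk (X 1 2 4) ⨟ ((mk hBox ⨟ mk (Z 1 2 a)) ⊠ mk (Z 1 2 (-1)))) ⊠ mk (wires 1))) ⊠ mk (wires 1)), g5, g6,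
    ← seq_assoc _ (mk (Z 2 1 0) ⊠ mk (wires 1)) (mk (Z 2 1 0)), seq_assoc (mk (Z 1 2 (a - 2))) _ (mk (Z 2 1 0) ⊠ mk (wires 1)), seq_assoc ((mk (X 1 2 4) ⨟ (mk (Z 1 2 0) ⊠ mk (Z 1 2 0)) ⨟ HC₄ ⨟ ((mk hBox ⨟ mk (Z 1 2 a) ⨟ (P₁ ⊠ mk (xLeafL 0 a))) ⊠ mk (Z 1 1 (-1)))) ⊠ mk (wires 1)), g7,
    ← seq_assoc ((mk (X 1 2 4) ⨟ (mk (Z 1 2 0) ⊠ mk (Z 1 2 0)) ⨟ HC₄ ⨟ ((mk hBox ⨟ mk (Z 1 2 a) ⨟ (P₁ ⊠ mk (xLeafL 0 a))) ⊠ mk (Z 1 1 (-1)))) ⊠ mk (wires 1)), g8, mv23_32, mv12_22s, scalar_par_one_two_seq_one, g10, seq_assoc (mk (Z 1 2 (a - 2))) _ (mk (Z 2 1 0)), seq_assoc _ (mk (wires 1) ⊠ mk (Z 2 1 0)) (mk (Z 2 1 0)),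
    par_Z_seq_Z 1 2 1 1 le_rfl, add_zero (0 : ZMod 8), ← g6, ← seq_assoc]

/-! ### Stage S4: the endgame -/

/-- Bookkeeping mover (scalars / associativity of `⊗`). [cite: JeandelPerdrixVilmart2018, §2.2 (only topology matters; scalars)] -/
private theorem hRl (A B : ZXClass 1 1) (t : ZXClass 0 0) : A ⊠ (t ⊠ B) = t ⊠ (A ⊠ B) := by
  rw [show A ⊠ (t ⊠ B) = (A ⊠ t) ⊠ B from (par_assoc' _ _ _).trans (cast_id _ _ _), ← scalar_par_one_comm]
  exact (par_assoc _ _ _).trans (cast_id _ _ _)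
/-- Bookkeeping mover (scalars / associativity of `⊗`). [cite: JeandelPerdrixVilmart2018, §2.2 (only topology matters; scalars)] -/
private theorem sXY (s : ZXClass 0 0) (X Y : ZXClass 1 1) : (s ⊠ X) ⊠ Y = s ⊠ (X ⊠ Y) := (par_assoc _ _ _).trans (cast_id _ _ _)
/-- Bookkeeping mover (scalars / associativity of `⊗`). [cite: JeandelPerdrixVilmart2018, §2.2 (only topology matters; scalars)] -/
private theorem mv22s' (s : ZXClass 0 0) (A : ZXClass 2 2) (B : ZXClass 2 1) : (s ⊠ A) ⨟ B = s ⊠ (A ⨟ B) := by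
  rw [scalar_par_seq_left, empty_par, cast_id]
/-- Bookkeeping mover (scalars / associativity of `⊗`). [cite: JeandelPerdrixVilmart2018, §2.2 (only topology matters; scalars)] -/
private theorem mv12_22 (A : ZXClass 1 2) (s : ZXClass 0 0) (B : ZXClass 2 2) : A ⨟ (s ⊠ B) = s ⊠ (A ⨟ B) := by
  rw [scalar_par_seq_right, empty_par, cast_id]

/-- A green state beside a `1 → 1` map, merged: `(Z^{(0,1)}(α) ⊗ A) ⨾ Z^{(2,1)} = A ⨾ Z(α)`. [cite: JeandelPerdrixVilmart2018, Fig. 1 (S1)] -/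
theorem Z_state_par_seq_merge (a : ZMod 8) (A : ZXClass 1 1) : (mk (Z 0 1 a) ⊠ A) ⨟ mk (Z 2 1 0) = A ⨟ mk (Z 1 1 a) := by
  rw [par_eq_seq_right (mk (Z 0 1 a)) A, empty_par, cast_id, seq_assoc, Z_par_seq_Z 0 1 1 1 le_rfl, add_zero]

/-- **Stage S4** (endgame of `control-alpha-with-triangles`): after (C1) twice and the junk removal, the remaining
Clifford+leaf diagram collapses onto `Z(α) ⨾ xLeafL 0 (-α) ⨾ Z(α)`. [cite: JeandelPerdrixVilmart2018, Appendix Lemma 17; Fig. 1] -/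
theorem controlAlpha_stage4 (a : ZMod 8) :
    mk (dumbbell 4 1) ⊠ (mk (Z 1 2 (a - 2)) ⨟ ((mk (X 1 2 4) ⨟ (mk (Z 1 2 0) ⊠ mk (Z 1 2 0)) ⨟ HC₄ ⨟ ((mk (Z 1 1 (-1)) ⨟ mk (xLeafL 0 1) ⨟ mk (Z 1 1 a)) ⊠ (mk (Z 1 1 (-1)) ⨟ mk (xLeafL 0 (-1))))) ⊠ mk (xLeafL 4 a)) ⨟ mk (Z 3 1 0)) =
      mk (dumbbell 4 a) ⊠ (mk invSqrtTwo ⊠ (mk invSqrtTwo ⊠ (mk invSqrtTwo ⊠ (mk (Z 1 1 a) ⨟ mk (xLeafL 0 (-a)) ⨟ mk (Z 1 1 a))))) := by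
  -- the phases `Z(-π/4)` slide into the splits
  have hC : (mk (X 1 2 4) ⨟ (mk (Z 1 2 0) ⊠ mk (Z 1 2 0)) ⨟ HC₄ ⨟ ((mk (Z 1 1 (-1)) ⨟ mk (xLeafL 0 1) ⨟ mk (Z 1 1 a)) ⊠ (mk (Z 1 1 (-1)) ⨟ mk (xLeafL 0 (-1))))) = (mk (X 1 2 4) ⨟ (mk (Z 1 2 (-1)) ⊠ mk (Z 1 2 (-1))) ⨟ HC₄ ⨟ ((mk (xLeafL 0 1) ⨟ mk (Z 1 1 a)) ⊠ mk (xLeafL 0 (-1)))) := by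
    rw [show (mk (Z 1 1 (-1)) ⨟ mk (xLeafL 0 1) ⨟ mk (Z 1 1 a)) ⊠ (mk (Z 1 1 (-1)) ⨟ mk (xLeafL 0 (-1))) =
        (mk (Z 1 1 (-1)) ⊠ mk (Z 1 1 (-1))) ⨟ ((mk (xLeafL 0 1) ⨟ mk (Z 1 1 a)) ⊠ mk (xLeafL 0 (-1))) from by rw [seq_assoc (mk (Z 1 1 (-1))), ← interchange],
      ← seq_assoc _ (mk (Z 1 1 (-1)) ⊠ mk (Z 1 1 (-1))), seq_assoc (mk (X 1 2 4)) (mk (Z 1 2 0) ⊠ mk (Z 1 2 0)) HC₄,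
      seq_assoc (mk (X 1 2 4)) _ (mk (Z 1 1 (-1)) ⊠ mk (Z 1 1 (-1))), hedgeSq_seq_phases, ← seq_assoc (mk (X 1 2 4))]
  -- the merge of the component, with the phase `Z(α)` taken out
  have hE : (mk (X 1 2 4) ⨟ (mk (Z 1 2 (-1)) ⊠ mk (Z 1 2 (-1))) ⨟ HC₄ ⨟ ((mk (xLeafL 0 1) ⨟ mk (Z 1 1 a)) ⊠ mk (xLeafL 0 (-1)))) ⨟ mk (Z 2 1 0) = ((mk (X 1 2 4) ⨟ (mk (Z 1 2 (-1)) ⊠ mk (Z 1 2 (-1))) ⨟ HC₄) ⨟ (mk (xLeafL 0 1) ⊠ mk (xLeafL 0 (-1))) ⨟ mk (Z 2 1 0)) ⨟ mk (Z 1 1 a) := by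
    rw [show (mk (xLeafL 0 1) ⨟ mk (Z 1 1 a)) ⊠ mk (xLeafL 0 (-1)) = (mk (xLeafL 0 1) ⊠ mk (xLeafL 0 (-1))) ⨟ (mk (Z 1 1 a) ⊠ mk (wires 1)) from by
        rw [← seq_id (mk (xLeafL 0 (-1))), ← interchange, seq_id], ← seq_assoc (mk (X 1 2 4) ⨟ (mk (Z 1 2 (-1)) ⊠ mk (Z 1 2 (-1))) ⨟ HC₄), seq_assoc _ (mk (Z 1 1 a) ⊠ mk (wires 1)) (mk (Z 2 1 0)),
      Z_par_seq_Z 1 1 1 1 le_rfl, add_zero a, show mk (Z (1 + 1) 1 a) = mk (Z 2 1 0) ⨟ mk (Z 1 1 a) from by rw [Z_seq_Z 2 1 1 le_rfl, zero_add], ← seq_assoc]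
  -- the flip of the second leaf, under the scalar `db 4 (π/4)`
  have hF : mk (dumbbell 4 1) ⊠ ((mk (X 1 2 4) ⨟ (mk (Z 1 2 (-1)) ⊠ mk (Z 1 2 (-1))) ⨟ HC₄) ⨟ (mk (xLeafL 0 1) ⊠ mk (xLeafL 0 (-1))) ⨟ mk (Z 2 1 0)) =
      mk (dumbbell 0 0) ⊠ (mk invSqrtTwo ⊠ (mk invSqrtTwo ⊠ (mk invSqrtTwo ⊠ (mk (Z 1 0 2) ⨟ mk (Z 0 1 0))))) := by
    rw [← scalar_par_one_two_seq_one, ← mv12_22, ← hRl, dumbbell_four_par_xLeafL_neg 0 1, hRl, mv12_22, scalar_par_one_two_seq_one,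
      show ((0 : ZMod 8) + 4) = 4 from by decide, xpisplit_czLeaves_merge]
  have hK : mk (dumbbell 0 0) ⊠ mk (xLeafL 4 a) = mk (dumbbell 4 a) ⊠ mk (xLeafL 0 (-a)) := by simpa using (dumbbell_four_par_xLeafL_neg 0 a).symm
  rw [hC, show mk (Z 3 1 0) = (mk (Z 2 1 0) ⊠ mk (wires 1)) ⨟ mk (Z 2 1 0) from by rw [Z_par_seq_Z 2 1 1 1 le_rfl, add_zero], ← seq_assoc _ (mk (Z 2 1 0) ⊠ mk (wires 1)),
    seq_assoc (mk (Z 1 2 (a - 2))) _ (mk (Z 2 1 0) ⊠ mk (wires 1)), interchange, seq_id, hE,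
    ← scalar_par_one_two_seq_one, ← mv12_22, ← sXY, ← scalar_par_seq_one, hF,
    scalar_par_seq_one, scalar_par_seq_one, scalar_par_seq_one, scalar_par_seq_one, sXY, sXY, sXY, sXY,
    mv12_22, mv12_22, mv12_22, mv12_22, scalar_par_one_two_seq_one, scalar_par_one_two_seq_one, scalar_par_one_two_seq_one, scalar_par_one_two_seq_one,
    seq_assoc (mk (Z 1 0 2)) (mk (Z 0 1 0)) (mk (Z 1 1 a)), Z_seq_Z 0 1 1 le_rfl, zero_add a,
    show (mk (Z 1 0 2) ⨟ mk (Z 0 1 a)) ⊠ mk (xLeafL 4 a) = (mk (Z 1 0 2) ⊠ mk (wires 1)) ⨟ (mk (Z 0 1 a) ⊠ mk (xLeafL 4 a)) from by rw [eq_comm, interchange, id_seq],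
    ← seq_assoc (mk (Z 1 2 (a - 2))), Z_seq_Z_par 1 1 1 0 le_rfl, show 2 + (a - 2) = a from by ring, seq_assoc, Z_state_par_seq_merge,
    scalar_par_scalar_par (mk (dumbbell 0 0)) (mk invSqrtTwo), scalar_par_scalar_par (mk (dumbbell 0 0)) (mk invSqrtTwo),
    scalar_par_scalar_par (mk (dumbbell 0 0)) (mk invSqrtTwo),
    ← seq_scalar_par_one (mk (dumbbell 0 0)) (mk (Z 1 (0 + 1) a)), ← scalar_par_seq_one (mk (dumbbell 0 0)) (mk (xLeafL 4 a)), hK,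
    scalar_par_seq_one, seq_scalar_par_one, ← seq_assoc,
    scalar_par_scalar_par (mk invSqrtTwo) (mk (dumbbell 4 a)), scalar_par_scalar_par (mk invSqrtTwo) (mk (dumbbell 4 a)),
    scalar_par_scalar_par (mk invSqrtTwo) (mk (dumbbell 4 a))]

/-! ### Stage S0: removing the gadgets of the two triangles (transposed orientation) -/

/-- **Stage S0a (transposed)**: the gadgets of `T` and of `X(π) ⨾ T` leave through the copy and cancel to `db 4 (-π/2)`:
`Z^{(1,2)} ⨾ ((T ⨾ Z(2α)) ⊗ (X(π) ⨾ T)) ⨾ X^{(2,1)} = db 4 (-π/2) ⊗ (Z^{(1,2)} ⨾ ((xLeafL 0 (π/4) ⨾ Z(π/4) ⨾ X(π/2) ⨾ Z(2α)) ⊗ (xLeafL π (π/4) ⨾ Z(π/4) ⨾ X(π/2))) ⨾ X^{(2,1)})`.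
[cite: JeandelPerdrixVilmart2018, Appendix Lemmas 19, 32; Fig. 1 (K)] -/
theorem controlAlpha_stage0aT (a : ZMod 8) :
    mk (Z 1 2 0) ⨟ ((mk triangle ⨟ mk (Z 1 1 (2 * a))) ⊠ (mk (X 1 1 4) ⨟ mk triangle)) ⨟ mk (X 2 1 0) =
      mk (dumbbell 4 (-2)) ⊠ (mk (Z 1 2 0) ⨟ ((mk (xLeafL 0 1) ⨟ mk (Z 1 1 1) ⨟ mk (X 1 1 2) ⨟ mk (Z 1 1 (2 * a))) ⊠ (mk (xLeafL 4 1) ⨟ mk (Z 1 1 1) ⨟ mk (X 1 1 2))) ⨟ mk (X 2 1 0)) := by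
  have hT : mk triangle = (mk (Z 1 2 0) ⨟ (mk (wires 1) ⊠ (mk (X 1 2 0) ⨟ (mk (Z 1 0 (-1)) ⊠ mk (Z 1 0 (-1)))))) ⨟ (mk (xLeafL 0 1) ⨟ mk (Z 1 1 1) ⨟ mk (X 1 1 2)) := by
    rw [mk_triangle, seq_assoc, seq_assoc, ← seq_assoc (mk (xLeafL 0 1))]
  rw [hT, show (((mk (Z 1 2 0) ⨟ (mk (wires 1) ⊠ (mk (X 1 2 0) ⨟ (mk (Z 1 0 (-1)) ⊠ mk (Z 1 0 (-1)))))) ⨟ (mk (xLeafL 0 1) ⨟ mk (Z 1 1 1) ⨟ mk (X 1 1 2))) ⨟ mk (Z 1 1 (2 * a))) ⊠ (mk (X 1 1 4) ⨟ ((mk (Z 1 2 0) ⨟ (mk (wires 1) ⊠ (mk (X 1 2 0) ⨟ (mk (Z 1 0 (-1)) ⊠ mk (Z 1 0 (-1)))))) ⨟ (mk (xLeafL 0 1) ⨟ mk (Z 1 1 1) ⨟ mk (X 1 1 2)))) = ((mk (Z 1 2 0) ⨟ (mk (wires 1) ⊠ (mk (X 1 2 0) ⨟ (mk (Z 1 0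 (-1)) ⊠ mk (Z 1 0 (-1)))))) ⊠ mk (wires 1)) ⨟ (((mk (xLeafL 0 1) ⨟ mk (Z 1 1 1) ⨟ mk (X 1 1 2)) ⨟ mk (Z 1 1 (2 * a))) ⊠ (mk (X 1 1 4) ⨟ ((mk (Z 1 2 0) ⨟ (mk (wires 1) ⊠ (mk (X 1 2 0) ⨟ (mk (Z 1 0 (-1)) ⊠ mk (Z 1 0 (-1)))))) ⨟ (mk (xLeafL 0 1) ⨟ mk (Z 1 1 1) ⨟ mk (X 1 1 2))))) from by
      rw [eq_comm, interchange, id_seq, ← seq_assoc (mk (Z 1 2 0) ⨟ (mk (wires 1) ⊠ (mk (X 1 2 0) ⨟ (mk (Z 1 0 (-1)) ⊠ mk (Z 1 0 (-1)))))) (mk (xLeafL 0 1) ⨟ mk (Z 1 1 1) ⨟ mk (X 1 1 2)) (mk (Z 1 1 (2 * a)))],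
    ← seq_assoc (mk (Z 1 2 0)) ((mk (Z 1 2 0) ⨟ (mk (wires 1) ⊠ (mk (X 1 2 0) ⨟ (mk (Z 1 0 (-1)) ⊠ mk (Z 1 0 (-1)))))) ⊠ mk (wires 1)), split_seq_gadget_par,
    show ((mk (xLeafL 0 1) ⨟ mk (Z 1 1 1) ⨟ mk (X 1 1 2)) ⨟ mk (Z 1 1 (2 * a))) ⊠ (mk (X 1 1 4) ⨟ ((mk (Z 1 2 0) ⨟ (mk (wires 1) ⊠ (mk (X 1 2 0) ⨟ (mk (Z 1 0 (-1)) ⊠ mk (Z 1 0 (-1)))))) ⨟ (mk (xLeafL 0 1) ⨟ mk (Z 1 1 1) ⨟ mk (X 1 1 2)))) = (mk (wires 1) ⊠ mk (X 1 1 4)) ⨟ (((mk (xLeafL 0 1) ⨟ mk (Z 1 1 1) ⨟ mk (X 1 1 2)) ⨟ mk (Z 1 1 (2 * a))) ⊠ ((mk (Z 1 2 0) ⨟ (mk (wires 1) ⊠ (mk (X 1 2 0) ⨟ (mk (Z 1 0 (-1)) ⊠ mk (Z 1 0 (-1)))))) ⨟ (mk (xLeafL 0 1) ⨟ mk (Z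 1 1 1) ⨟ mk (X 1 1 2)))) from by
      rw [eq_comm, interchange, id_seq],
    seq_assoc (mk (Z 1 2 0) ⨟ (mk (wires 1) ⊠ (mk (X 1 2 0) ⨟ (mk (Z 1 0 (-1)) ⊠ mk (Z 1 0 (-1)))))) (mk (Z 1 2 0)), ← seq_assoc (mk (Z 1 2 0)) (mk (wires 1) ⊠ mk (X 1 1 4)), split_seq_par_X_pi,
    seq_assoc (mk (X 1 1 4) ⨟ mk (Z 1 2 0)) (mk (X 1 1 4) ⊠ mk (wires 1)),
    show (mk (X 1 1 4) ⊠ mk (wires 1)) ⨟ (((mk (xLeafL 0 1) ⨟ mk (Z 1 1 1) ⨟ mk (X 1 1 2)) ⨟ mk (Z 1 1 (2 * a))) ⊠ ((mk (Z 1 2 0) ⨟ (mk (wires 1) ⊠ (mk (X 1 2 0) ⨟ (mk (Z 1 0 (-1)) ⊠ mk (Z 1 0 (-1)))))) ⨟ (mk (xLeafL 0 1) ⨟ mk (Z 1 1 1) ⨟ mk (X 1 1 2)))) = (mk (wires 1) ⊠ (mk (Z 1 2 0) ⨟ (mk (wires 1) ⊠ (mk (X 1 2 0) ⨟ (mk (Z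 1 0 (-1)) ⊠ mk (Z 1 0 (-1))))))) ⨟ ((mk (X 1 1 4) ⨟ ((mk (xLeafL 0 1) ⨟ mk (Z 1 1 1) ⨟ mk (X 1 1 2)) ⨟ mk (Z 1 1 (2 * a)))) ⊠ (mk (xLeafL 0 1) ⨟ mk (Z 1 1 1) ⨟ mk (X 1 1 2))) from by
      rw [interchange, id_seq, eq_comm, interchange, id_seq],
    seq_assoc (mk (X 1 1 4)) (mk (Z 1 2 0)), ← seq_assoc (mk (Z 1 2 0)) (mk (wires 1) ⊠ (mk (Z 1 2 0) ⨟ (mk (wires 1) ⊠ (mk (X 1 2 0) ⨟ (mk (Z 1 0 (-1)) ⊠ mk (Z 1 0 (-1))))))), split_seq_par_gadget,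
    ← seq_assoc (mk (X 1 1 4)) ((mk (Z 1 2 0) ⨟ (mk (wires 1) ⊠ (mk (X 1 2 0) ⨟ (mk (Z 1 0 (-1)) ⊠ mk (Z 1 0 (-1)))))) ⨟ mk (Z 1 2 0)), ← seq_assoc (mk (X 1 1 4)) (mk (Z 1 2 0) ⨟ (mk (wires 1) ⊠ (mk (X 1 2 0) ⨟ (mk (Z 1 0 (-1)) ⊠ mk (Z 1 0 (-1)))))) (mk (Z 1 2 0)), ← seq_assoc (mk (Z 1 2 0) ⨟ (mk (wires 1) ⊠ (mk (X 1 2 0) ⨟ (mk (Z 1 0 (-1)) ⊠ mk (Z 1 0 (-1)))))), ← seq_assoc (mk (Z 1 2 0) ⨟ (mk (wires 1) ⊠ (mk (X 1 2 0) ⨟ (mk (Z 1 0 (-1)) ⊠ mk (Z 1 0 (-1)))))), ← seq_assoc (mk (Z 1 2 0) ⨟ (mk (wires 1) ⊠ (mk (X 1 2 0) ⨟ (mk (Z 1 0 (-1)) ⊠ mk (Z 1 0 (-1)))))) (mk (X 1 1 4)) (mk (Z 1 2 0) ⨟ (mk (wires 1) ⊠ (mk (X 1 2 0) ⨟ (mk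 (Z 1 0 (-1)) ⊠ mk (Z 1 0 (-1)))))),
    gadgetNode_seq_X_pi, seq_assoc (mk (X 1 1 4)) (mk (Z 1 2 0) ⨟ (mk (wires 1) ⊠ (mk (X 1 2 4) ⨟ (mk (Z 1 0 (-1)) ⊠ mk (Z 1 0 (-1)))))) (mk (Z 1 2 0) ⨟ (mk (wires 1) ⊠ (mk (X 1 2 0) ⨟ (mk (Z 1 0 (-1)) ⊠ mk (Z 1 0 (-1)))))), gadgetNode_pi_seq_gadgetNode, seq_scalar_par_one, seq_id,
    show ∀ (t : ZXClass 0 0) (A : ZXClass 1 1) (B : ZXClass 1 2), (t ⊠ A) ⨟ B = t ⊠ (A ⨟ B) from fun t A B => by rw [scalar_par_seq_left, empty_par, cast_id],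
    show ∀ (t : ZXClass 0 0) (A : ZXClass 1 2) (B : ZXClass 2 2), (t ⊠ A) ⨟ B = t ⊠ (A ⨟ B) from fun t A B => by rw [scalar_par_seq_left, empty_par, cast_id],
    scalar_par_one_two_seq_one, K1_red, seq_assoc (mk (Z 1 2 0)) (mk (X 1 1 4) ⊠ mk (X 1 1 4)), interchange,
    ← seq_assoc (mk (X 1 1 4)) (mk (X 1 1 4)), xphase_seq_xphase, show (4 : ZMod 8) + 4 = 0 from by decide, X_one_one, id_seq,
    ← seq_assoc (mk (X 1 1 4)) (mk (xLeafL 0 1) ⨟ mk (Z 1 1 1)) (mk (X 1 1 2)), ← seq_assoc (mk (X 1 1 4)) (mk (xLeafL 0 1)) (mk (Z 1 1 1)), X_pi_seq_xLeafL]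

/-- **Stage S0c**: `E4b = 1/√2 ⊗ D2`, by the Hadamard form of (XZP) (`split_xsplit_hBox_merge`) read backwards.
[cite: JeandelPerdrixVilmart2018, Fig. 1 (B2), (EU), (H)] -/
theorem controlAlpha_stage0c (a : ZMod 8) :
    PRE ⨟ (mk (Z 1 2 (2 * a + 4)) ⊠ mk (wires 1)) ⨟ ((mk hBox ⊠ mk hBox) ⊠ mk (wires 1)) ⨟ (mk (wires 1) ⊠ mk (Z 2 1 (-1))) ⨟ ((mk (Z 1 1 (-1)) ⨟ mk (xLeafL 0 1)) ⊠ mk (xLeafL 4 1)) ⨟ mk (Z 2 1 0) = mk invSqrtTwo ⊠ (mk (X 1 2 0) ⨟ ((mk (Z 1 1 (-2)) ⨟ mk (X 1 1 (2 * a + 4)) ⨟ mk (Z 1 1 (-1)) ⨟ mk (xLeafL 0 1)) ⊠ (mk (Z 1 1 1) ⨟ mk (xLeafL 4 1))) ⨟ mk (Z 2 1 0)) := by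
  have h1 : PRE ⨟ (mk (Z 1 2 (2 * a + 4)) ⊠ mk (wires 1)) ⨟ ((mk hBox ⊠ mk hBox) ⊠ mk (wires 1)) =
      mk (Z 1 1 (-2)) ⨟ (mk (Z 1 2 0) ⨟ (mk (X 1 2 0) ⊠ mk hBox)) ⨟ ((mk (X 1 1 (2 * a + 4)) ⊠ mk (wires 1)) ⊠ mk (wires 1)) := by
    rw [seq_assoc _ (mk (Z 1 2 (2 * a + 4)) ⊠ mk (wires 1)), ← seq_par_wires, seq_assoc (mk (Z 1 1 (-2)) ⨟ mk (Z 1 2 0)), interchange, seq_id,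
      ← seq_assoc (mk hBox), ← X_split_eq, ← xsplit_seq_xphase_par (2 * a + 4),
      show (mk (X 1 2 0) ⨟ (mk (X 1 1 (2 * a + 4)) ⊠ mk (wires 1))) ⊠ mk hBox = (mk (X 1 2 0) ⊠ mk hBox) ⨟ ((mk (X 1 1 (2 * a + 4)) ⊠ mk (wires 1)) ⊠ mk (wires 1)) from by rw [← seq_id (mk hBox), ← interchange, seq_id],
      ← seq_assoc, seq_assoc (mk (Z 1 1 (-2)))]
  have h2 : ((mk (X 1 1 (2 * a + 4)) ⊠ mk (wires 1)) ⊠ mk (wires 1)) ⨟ (mk (wires 1) ⊠ mk (Z 2 1 (-1))) = (mk (wires 1) ⊠ mk (Z 2 1 0)) ⨟ (mk (X 1 1 (2 * a + 4)) ⊠ mk (Z 1 1 (-1))) := by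
    rw [show (mk (X 1 1 (2 * a + 4)) ⊠ mk (wires 1)) ⊠ mk (wires 1) = mk (X 1 1 (2 * a + 4)) ⊠ mk (wires 2) from by rw [← wires_par_wires 1 1]; exact (par_assoc _ _ _).trans (cast_id _ _ _),
      interchange, seq_id, id_seq, show mk (Z 2 1 (-1)) = mk (Z 2 1 0) ⨟ mk (Z 1 1 (-1)) from by rw [Z_seq_Z 2 1 1 le_rfl, zero_add],
      eq_comm, interchange, id_seq]
  have h3 : (mk (Z 1 1 6) ⊠ mk (Z 1 1 2)) ⨟ (mk (X 1 1 (2 * a + 4)) ⊠ mk (Z 1 1 (-1))) ⨟ ((mk (Z 1 1 (-1)) ⨟ mk (xLeafL 0 1)) ⊠ mk (xLeafL 4 1)) =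
      (mk (Z 1 1 (-2)) ⨟ mk (X 1 1 (2 * a + 4)) ⨟ mk (Z 1 1 (-1)) ⨟ mk (xLeafL 0 1)) ⊠ (mk (Z 1 1 1) ⨟ mk (xLeafL 4 1)) := by
    rw [interchange, interchange, phase_seq_phase, show (2 : ZMod 8) + -1 = 1 from by decide, show (6 : ZMod 8) = -2 from by decide, ← seq_assoc]
  rw [h1, seq_assoc _ (((mk (X 1 1 (2 * a + 4)) ⊠ mk (wires 1)) ⊠ mk (wires 1))) (mk (wires 1) ⊠ mk (Z 2 1 (-1))), h2, ← seq_assoc _ (mk (wires 1) ⊠ mk (Z 2 1 0)) (mk (X 1 1 (2 * a + 4)) ⊠ mk (Z 1 1 (-1))),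
    seq_assoc (mk (Z 1 1 (-2))) _ (mk (wires 1) ⊠ mk (Z 2 1 0)), split_xsplit_hBox_merge, seq_scalar_par_one',
    ← seq_assoc (mk (Z 1 1 (-2))) (mk (Z 1 1 2) ⨟ mk (X 1 2 0)), ← seq_assoc (mk (Z 1 1 (-2))) (mk (Z 1 1 2)) (mk (X 1 2 0)), phase_seq_phase, neg_add_cancel, Z_one_one, id_seq,
    mv12_22'', mv12_22'', scalar_par_one_two_seq_one, seq_assoc (mk (X 1 2 0)) (mk (Z 1 1 6) ⊠ mk (Z 1 1 2)), seq_assoc (mk (X 1 2 0)) _ ((mk (Z 1 1 (-1)) ⨟ mk (xLeafL 0 1)) ⊠ mk (xLeafL 4 1)), h3]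
  where
  seq_scalar_par_one' (A : ZXClass 1 1) (s : ZXClass 0 0) (B : ZXClass 1 2) : A ⨟ (s ⊠ B) = s ⊠ (A ⨟ B) := by
    rw [scalar_par_seq_right, empty_par, cast_id]
  mv12_22'' (s : ZXClass 0 0) (A : ZXClass 1 2) (B : ZXClass 2 2) : (s ⊠ A) ⨟ B = s ⊠ (A ⨟ B) := by
    rw [scalar_par_seq_left, empty_par, cast_id]

/-- **Stage S0a**: the gadgets of the two transposed triangles cancel,
`X^{(1,2)} ⨾ ((Z(2α) ⨾ Tᵗ) ⊗ (Tᵗ ⨾ X(π))) ⨾ Z^{(2,1)} = db 4 (-π/2) ⊗ D1'`. [cite: JeandelPerdrixVilmart2018, Appendix Lemmas 19, 32; Fig. 1 (K)] -/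
theorem controlAlpha_stage0a (a : ZMod 8) :
    mk (X 1 2 0) ⨟ ((mk (Z 1 1 (2 * a)) ⨟ (mk triangle).transpose) ⊠ ((mk triangle).transpose ⨟ mk (X 1 1 4))) ⨟ mk (Z 2 1 0) =
      mk (dumbbell 4 (-2)) ⊠ (mk (X 1 2 0) ⨟ ((mk (Z 1 1 (2 * a)) ⨟ mk (X 1 1 2) ⨟ mk (Z 1 1 1) ⨟ mk (xLeafL 0 1)) ⊠ (mk (X 1 1 2) ⨟ mk (Z 1 1 1) ⨟ mk (xLeafL 4 1))) ⨟ mk (Z 2 1 0)) := by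
  have h := congrArg transpose (controlAlpha_stage0aT a)
  simp [mk_transpose_dumbbell, mk_transpose_xLeafL] at h
  simp only [seq_assoc] at h ⊢
  exact h

/-- **Stage S0b**: the Euler conjugation of `Z(2α)` on the first branch, `D1' = 1/√2 ⊗ db 4 (π/2) ⊗ D2`.
[cite: JeandelPerdrixVilmart2018, Appendix Lemma 16 (Euler)] -/
theorem controlAlpha_stage0b (a : ZMod 8) :
    (mk (X 1 2 0) ⨟ ((mk (Z 1 1 (2 * a)) ⨟ mk (X 1 1 2) ⨟ mk (Z 1 1 1) ⨟ mk (xLeafL 0 1)) ⊠ (mk (X 1 1 2) ⨟ mk (Z 1 1 1) ⨟ mk (xLeafL 4 1))) ⨟ mk (Z 2 1 0)) = mk invSqrtTwo ⊠ (mk (dumbbell 4 2) ⊠ (mk (X 1 2 0) ⨟ ((mk (Z 1 1 (-2)) ⨟ mk (X 1 1 (2 * a + 4)) ⨟ mk (Z 1 1 (-1)) ⨟ mk (xLeafL 0 1)) ⊠ (mk (Z 1 1 1) ⨟ mk (xLeafL 4 1))) ⨟ mk (Z 2 1 0))) := by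
  rw [show (mk (Z 1 1 (2 * a)) ⨟ mk (X 1 1 2) ⨟ mk (Z 1 1 1) ⨟ mk (xLeafL 0 1)) ⊠ (mk (X 1 1 2) ⨟ mk (Z 1 1 1) ⨟ mk (xLeafL 4 1)) =
      (mk (wires 1) ⊠ mk (X 1 1 2)) ⨟ ((mk (Z 1 1 (2 * a)) ⨟ mk (X 1 1 2) ⨟ mk (Z 1 1 1) ⨟ mk (xLeafL 0 1)) ⊠ (mk (Z 1 1 1) ⨟ mk (xLeafL 4 1))) from by
      rw [interchange, id_seq, seq_assoc (mk (X 1 1 2)) (mk (Z 1 1 1)) (mk (xLeafL 4 1))],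
    ← seq_assoc (mk (X 1 2 0)), X_seq_par_X 1 1 1 1 le_rfl, zero_add, ← xsplit_seq_xphase_par 2, seq_assoc (mk (X 1 2 0)) (mk (X 1 1 2) ⊠ mk (wires 1)),
    show (mk (X 1 1 2) ⊠ mk (wires 1)) ⨟ ((mk (Z 1 1 (2 * a)) ⨟ mk (X 1 1 2) ⨟ mk (Z 1 1 1) ⨟ mk (xLeafL 0 1)) ⊠ (mk (Z 1 1 1) ⨟ mk (xLeafL 4 1))) =
      ((mk (X 1 1 2) ⨟ mk (Z 1 1 (2 * a)) ⨟ mk (X 1 1 2)) ⨟ mk (Z 1 1 1) ⨟ mk (xLeafL 0 1)) ⊠ (mk (Z 1 1 1) ⨟ mk (xLeafL 4 1)) from by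
      rw [interchange, id_seq, ← seq_assoc, ← seq_assoc, ← seq_assoc],
    euler_conj, scalar_par_seq_one, scalar_par_seq_one, scalar_par_seq_one, scalar_par_seq_one,
    show ∀ (s : ZXClass 0 0) (A B : ZXClass 1 1), (s ⊠ A) ⊠ B = s ⊠ (A ⊠ B) from fun s A B => (par_assoc _ _ _).trans (cast_id _ _ _),
    show ∀ (s : ZXClass 0 0) (A B : ZXClass 1 1), (s ⊠ A) ⊠ B = s ⊠ (A ⊠ B) from fun s A B => (par_assoc _ _ _).trans (cast_id _ _ _),
    mv12_22x, mv12_22x, scalar_par_one_two_seq_one, scalar_par_one_two_seq_one,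
    seq_assoc _ (mk (Z 1 1 (-2))) (mk (Z 1 1 1)), phase_seq_phase, show (-2 : ZMod 8) + 1 = -1 from by decide]
  where
  mv12_22x (A : ZXClass 1 2) (s : ZXClass 0 0) (B : ZXClass 2 2) : A ⨟ (s ⊠ B) = s ⊠ (A ⨟ B) := by
    rw [scalar_par_seq_right, empty_par, cast_id]

/-! ### The lemma -/

/-- **JPV LICS 2019, Lemma `control-alpha-with-triangles`** (NF-L1): for every `α ∈ (π/4)ℤ`,
`X^{(1,2)} ⨾ ((Z(2α) ⨾ Tᵗ) ⊗ (Tᵗ ⨾ X(π))) ⨾ Z^{(2,1)} = Z(α) ⨾ xLeafL 0 (-α) ⨾ Z(α)`.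
Proof after the printed one (figures `control-alpha-with-triangles_00–13`): gadget removal, Euler conjugation, (XZP),
the trivial pair of leaves, (C1), Hadamard cancellation, (U), the junk identity (C1 fed by a state), and the endgame.
[cite: JeandelPerdrixVilmart2018, Appendix Lemmas 16, 17, 19, 32; JPV, *A Generic Normal Form for ZX-Diagrams* (LICS 2019), Appendix] -/
theorem control_alpha_with_triangles (a : ZMod 8) :
    mk (X 1 2 0) ⨟ ((mk (Z 1 1 (2 * a)) ⨟ (mk triangle).transpose) ⊠ ((mk triangle).transpose ⨟ mk (X 1 1 4))) ⨟ mk (Z 2 1 0) =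
      mk (Z 1 1 a) ⨟ mk (xLeafL 0 (-a)) ⨟ mk (Z 1 1 a) := by
  have h3 : (PRE ⨟ (mk (Z 1 3 (a + 4)) ⊠ mk (wires 1)) ⨟ ((P₁ ⊠ mk (xLeafL 0 a)) ⊠ RBLK[a]) ⨟ mk (Z 3 1 0)) = mk invSqrtTwo ⊠ (mk (Z 1 2 (a - 2)) ⨟ ((mk (X 1 2 4) ⨟ (mk (Z 1 2 0) ⊠ mk (Z 1 2 0)) ⨟ HC₄ ⨟ ((mk (Z 1 1 (-1)) ⨟ mk (xLeafL 0 1) ⨟ mk (Z 1 1 a)) ⊠ (mk (Z 1 1 (-1)) ⨟ mk (xLeafL 0 (-1))))) ⊠ mk (xLeafL 4 a)) ⨟ mk (Z 3 1 0)) := by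
    rw [controlAlpha_stage3ab, controlAlpha_stage3c, controlAlpha_stage3d]
  have hL : (PRE ⨟ (mk (Z 1 3 (a + 4)) ⊠ mk (wires 1)) ⨟ ((P₁ ⊠ mk (xLeafL 0 a)) ⊠ BLK[a]) ⨟ mk (Z 3 1 0)) = mk invSqrtTwo ⊠ (mk invSqrtTwo ⊠ (mk invSqrtTwo ⊠ (mk invSqrtTwo ⊠ (mk (Z 1 1 a) ⨟ mk (xLeafL 0 (-a)) ⨟ mk (Z 1 1 a))))) := by
    refine cancel_dumbbell_four_one_one a ?_
    rw [controlAlpha_stage2, h3, scalar_par_scalar_par (mk (dumbbell 4 1)) (mk invSqrtTwo), controlAlpha_stage4, scalar_par_scalar_par (mk invSqrtTwo) (mk (dumbbell 4 a))]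
  have hB : (PRE ⨟ (mk (Z 1 2 (2 * a + 4)) ⊠ mk (wires 1)) ⨟ ((mk hBox ⊠ mk hBox) ⊠ mk (wires 1)) ⨟ (mk (wires 1) ⊠ mk (Z 2 1 (-1))) ⨟ ((mk (Z 1 1 (-1)) ⨟ mk (xLeafL 0 1)) ⊠ mk (xLeafL 4 1)) ⨟ mk (Z 2 1 0)) = mk invSqrtTwo ⊠ (mk invSqrtTwo ⊠ (mk (Z 1 1 a) ⨟ mk (xLeafL 0 (-a)) ⨟ mk (Z 1 1 a))) := by
    have h := congrArg (fun Y => mk (dumbbell 0 0) ⊠ (mk (dumbbell 0 0) ⊠ Y)) (controlAlpha_stage1 a)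
    simp only [hL, sqrt_two_par_invSqrtTwo_par_one] at h
    exact h.symm
  have hD2 : (mk (X 1 2 0) ⨟ ((mk (Z 1 1 (-2)) ⨟ mk (X 1 1 (2 * a + 4)) ⨟ mk (Z 1 1 (-1)) ⨟ mk (xLeafL 0 1)) ⊠ (mk (Z 1 1 1) ⨟ mk (xLeafL 4 1))) ⨟ mk (Z 2 1 0)) = mk invSqrtTwo ⊠ (mk (Z 1 1 a) ⨟ mk (xLeafL 0 (-a)) ⨟ mk (Z 1 1 a)) := by
    have h := congrArg (fun Y => mk (dumbbell 0 0) ⊠ Y) (controlAlpha_stage0c a)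
    simp only [hB, sqrt_two_par_invSqrtTwo_par_one] at h
    exact h.symm
  rw [controlAlpha_stage0a, controlAlpha_stage0b, hD2, scalar_par_scalar_par (mk (dumbbell 4 (-2))) (mk invSqrtTwo),
    show ∀ Y : ZXClass 1 1, mk (dumbbell 4 (-2)) ⊠ (mk (dumbbell 4 2) ⊠ Y) = (mk (dumbbell 4 (-2)) ⊠ mk (dumbbell 4 2)) ⊠ Y from fun Y => (par_assoc' _ _ _).trans (cast_id _ _ _),
    dumbbell_four_mul, show (-2 : ZMod 8) + 2 = 0 from by decide, dumbbell_four_zero,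
    show ∀ Y : ZXClass 1 1, (mk (dumbbell 0 0) ⊠ mk (dumbbell 0 0)) ⊠ Y = mk (dumbbell 0 0) ⊠ (mk (dumbbell 0 0) ⊠ Y) from fun Y => (par_assoc _ _ _).trans (cast_id _ _ _),
    sqrt_two_par_invSqrtTwo_par_one, invSqrtTwo_par_sqrt_two_par_one]

end ZXClass

end Literature.Computability.QuantumComplexity
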